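import Summits.Ventures.HodgeRepro2.T5SU11SphericalCfunClosed

/-!
# Two improper Beta-type integrals: `∫_ℝ (1 + u²)^{-s} du = √π Γ(s − 1/2)/Γ(s)` and
`∫_0^∞ x^{a−1} (1 + x)^{-(a+b)} dx = Γ(a) Γ(b)/Γ(a + b)`

Both are obtained from the Beta / Wallis integrals of `T5SU11SphericalCfunClosed` by ONE change of
variables through `MeasureTheory.integral_image_eq_integral_abs_deriv_smul`, which needs no
integrability hypothesis: `u = tan θ` on `(−π/2, π/2)` (image `ℝ`, Jacobian `1/cos² θ`) turns
`(1 + u²)^{-s}` into `cos^{2s−2} θ` (`integral_one_add_sq_rpow_neg`; scaled form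
`∫_ℝ (c² + u²)^{-s} du = c^{1−2s} √π Γ(s − 1/2)/Γ(s)`, `integral_sq_add_sq_rpow_neg`), and
`x = v/(1 − v)` on `(0, 1)` (image `(0, ∞)`, Jacobian `(1 − v)^{-2}`) turns `x^{a−1} (1 + x)^{-(a+b)}`
into `v^{a−1} (1 − v)^{b−1}` (`integral_rpow_mul_one_add_rpow_neg`). Integrability of every integrand
is then read off A POSTERIORI: a non-integrable function has Bochner integral `0`, while these integrals
are positive Gamma quotients (`intervalIntegrable_sin_rpow_mul_cos_rpow`, `integrable_one_add_sq_rpow_neg`,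
`integrableOn_rpow_mul_one_add_rpow_neg`). These are the two one-dimensional integrals of the
Iwasawa-coordinate evaluation of the spherical transform of the lowest-weight coefficient modulus
`(1 − |g·0|²)^{k/2}`. Nothing is claimed about (N).

Blind lane: Mathlib + the HodgeRepro2 prefix only; no sorry; axioms ⊆ {propext, Classical.choice,
Quot.sound}.
-/

namespace Summit.Ventures.HodgeRepro2.T5SU11BetaImproper

open MeasureTheory Metric Set Filter Topology intervalIntegral
open T5SU11SphericalXiLog T5SU11SphericalCfunClosed
open scoped Real

/-! ### Integrability of the Wallis integrands, a posteriori -/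

/-- `sin^p θ cos^q θ` is interval-integrable on `[0, π/2]` for `p, q > −1`: its integral is a positive
Gamma quotient, while a non-integrable function integrates to `0`. -/
theorem intervalIntegrable_sin_rpow_mul_cos_rpow {p q : ℝ} (hp : -1 < p) (hq : -1 < q) :
    IntervalIntegrable (fun θ => Real.sin θ ^ p * Real.cos θ ^ q) volume 0 (π / 2) := by
  by_contra h
  have h0 := intervalIntegral.integral_undef h
  rw [integral_sin_rpow_mul_cos_rpow hp hq] at h0
  have h1 : 0 < Real.Gamma ((p + 1) / 2) := Real.Gamma_pos_of_pos (by linarith)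
  have h2 : 0 < Real.Gamma ((q + 1) / 2) := Real.Gamma_pos_of_pos (by linarith)
  have h3 : 0 < Real.Gamma ((p + q) / 2 + 1) := Real.Gamma_pos_of_pos (by linarith)
  have : 0 < Real.Gamma ((p + 1) / 2) * Real.Gamma ((q + 1) / 2)
      / (2 * Real.Gamma ((p + q) / 2 + 1)) := by positivity
  linarith

/-- `cos^q θ` is interval-integrable on `[0, π/2]` for `q > −1`. -/
theorem intervalIntegrable_cos_rpow {q : ℝ} (hq : -1 < q) :
    IntervalIntegrable (fun θ => Real.cos θ ^ q) volume 0 (π / 2) := by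
  have h := intervalIntegrable_sin_rpow_mul_cos_rpow (by norm_num : (-1 : ℝ) < 0) hq
  simpa only [Real.rpow_zero, one_mul] using h

/-- `cos^q θ` is interval-integrable on `[−π/2, 0]` for `q > −1` (the cosine is even). -/
theorem intervalIntegrable_cos_rpow_neg {q : ℝ} (hq : -1 < q) :
    IntervalIntegrable (fun θ => Real.cos θ ^ q) volume (-(π / 2)) 0 := by
  have h := (IntervalIntegrable.iff_comp_neg (f := fun θ => Real.cos θ ^ q) (a := 0)
    (b := π / 2)).mp (intervalIntegrable_cos_rpow hq)
  simp only [Real.cos_neg, neg_zero] at h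
  exact h.symm

/-- `cos^q θ` is interval-integrable on `[−π/2, π/2]` for `q > −1`. -/
theorem intervalIntegrable_cos_rpow_symm {q : ℝ} (hq : -1 < q) :
    IntervalIntegrable (fun θ => Real.cos θ ^ q) volume (-(π / 2)) (π / 2) :=
  (intervalIntegrable_cos_rpow_neg hq).trans (intervalIntegrable_cos_rpow hq)

/-- **Wallis on the symmetric interval**: `∫_{-π/2}^{π/2} cos^q θ dθ = √π Γ((q+1)/2)/Γ(q/2 + 1)` for
`q > −1`. -/
theorem integral_cos_rpow_symm {q : ℝ} (hq : -1 < q) :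
    ∫ θ in (-(π / 2))..(π / 2), Real.cos θ ^ q
      = √π * Real.Gamma ((q + 1) / 2) / Real.Gamma (q / 2 + 1) := by
  rw [integral_symm_of_even (fun θ => by simp only [Real.cos_neg]) (by positivity)
    (intervalIntegrable_cos_rpow_symm hq), integral_cos_rpow hq]
  have hΓ : 0 < Real.Gamma (q / 2 + 1) := Real.Gamma_pos_of_pos (by linarith)
  field_simp

/-! ### `∫_ℝ (1 + u²)^{-s} du` -/

/-- On `(−π/2, π/2)`: `|1/cos² θ| · (1 + tan² θ)^{-s} = cos^{2s−2} θ`. -/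
lemma abs_inv_cos_sq_smul_one_add_tan_sq_rpow {θ : ℝ} (hθ : θ ∈ Ioo (-(π / 2)) (π / 2)) (s : ℝ) :
    |1 / Real.cos θ ^ 2| • (1 + Real.tan θ ^ 2) ^ (-s) = Real.cos θ ^ (2 * s - 2) := by
  have hc : 0 < Real.cos θ := Real.cos_pos_of_mem_Ioo hθ
  have h1 : (0 : ℝ) ≤ 1 + Real.tan θ ^ 2 := by positivity
  rw [smul_eq_mul, abs_of_pos (one_div_pos.mpr (pow_pos hc 2)), Real.rpow_neg h1,
    ← Real.inv_rpow h1, Real.inv_one_add_tan_sq hc.ne', ← Real.rpow_two, ← Real.rpow_mul hc.le,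
    Real.rpow_sub hc]
  ring

/-- **`∫_ℝ (1 + u²)^{-s} du = √π Γ(s − 1/2)/Γ(s)`** for `s > 1/2` (the substitution `u = tan θ`). -/
theorem integral_one_add_sq_rpow_neg {s : ℝ} (hs : 1 / 2 < s) :
    ∫ u : ℝ, (1 + u ^ 2) ^ (-s) = √π * Real.Gamma (s - 1 / 2) / Real.Gamma s := by
  have hder : ∀ θ ∈ Ioo (-(π / 2)) (π / 2),
      HasDerivWithinAt Real.tan (1 / Real.cos θ ^ 2) (Ioo (-(π / 2)) (π / 2)) θ :=
    fun θ hθ => (Real.hasDerivAt_tan_of_mem_Ioo hθ).hasDerivWithinAt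
  have key := integral_image_eq_integral_abs_deriv_smul measurableSet_Ioo hder Real.injOn_tan
    (fun u : ℝ => (1 + u ^ 2) ^ (-s))
  rw [Real.image_tan_Ioo, Measure.restrict_univ] at key
  rw [key, setIntegral_congr_fun measurableSet_Ioo
    (fun θ hθ => abs_inv_cos_sq_smul_one_add_tan_sq_rpow hθ s),
    ← integral_Ioc_eq_integral_Ioo, ← intervalIntegral.integral_of_le (by linarith [Real.pi_pos]),
    integral_cos_rpow_symm (by linarith), show (2 * s - 2 + 1) / 2 = s - 1 / 2 by ring,
    show (2 * s - 2) / 2 + 1 = s by ring]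

/-- `(1 + u²)^{-s}` is integrable on `ℝ` for `s > 1/2` (a posteriori). -/
theorem integrable_one_add_sq_rpow_neg {s : ℝ} (hs : 1 / 2 < s) :
    Integrable (fun u : ℝ => (1 + u ^ 2) ^ (-s)) := by
  by_contra h
  have h0 := integral_undef h
  rw [integral_one_add_sq_rpow_neg hs] at h0
  have h1 : 0 < Real.Gamma (s - 1 / 2) := Real.Gamma_pos_of_pos (by linarith)
  have h2 : 0 < Real.Gamma s := Real.Gamma_pos_of_pos (by linarith)
  have : 0 < √π * Real.Gamma (s - 1 / 2) / Real.Gamma s := by positivity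
  linarith

/-- **The scaled form**: `∫_ℝ (c² + u²)^{-s} du = c^{1−2s} √π Γ(s − 1/2)/Γ(s)` for `s > 1/2`, `c > 0`. -/
theorem integral_sq_add_sq_rpow_neg {s c : ℝ} (hs : 1 / 2 < s) (hc : 0 < c) :
    ∫ u : ℝ, (c ^ 2 + u ^ 2) ^ (-s)
      = c ^ (1 - 2 * s) * (√π * Real.Gamma (s - 1 / 2) / Real.Gamma s) := by
  have h := MeasureTheory.Measure.integral_comp_mul_left (fun u : ℝ => (1 + u ^ 2) ^ (-s)) c⁻¹
  rw [inv_inv, abs_of_pos hc, smul_eq_mul, integral_one_add_sq_rpow_neg hs] at h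
  have hpt : ∀ u : ℝ, (c ^ 2 + u ^ 2) ^ (-s) = (c ^ 2) ^ (-s) * (1 + (c⁻¹ * u) ^ 2) ^ (-s) := by
    intro u
    rw [← Real.mul_rpow (by positivity) (by positivity)]
    congr 1
    field_simp
  simp_rw [hpt]
  rw [MeasureTheory.integral_const_mul, h, ← Real.rpow_two, ← Real.rpow_mul hc.le,
    show 1 - 2 * s = 1 + 2 * -s by ring, Real.rpow_add hc, Real.rpow_one]
  ring

/-! ### `∫_0^∞ x^{a−1} (1 + x)^{-(a+b)} dx` -/

/-- The substitution `x = v/(1 − v)` maps `(0, 1)` onto `(0, ∞)`. -/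
lemma image_div_one_sub_Ioo : (fun v : ℝ => v / (1 - v)) '' Ioo 0 1 = Ioi 0 := by
  ext x
  constructor
  · rintro ⟨v, ⟨hv0, hv1⟩, rfl⟩
    exact div_pos hv0 (by linarith)
  · intro hx
    have hx' : (0 : ℝ) < x := hx
    have h1 : (0 : ℝ) < 1 + x := by linarith
    refine ⟨x / (1 + x), ⟨div_pos hx' h1, (div_lt_one h1).mpr (by linarith)⟩, ?_⟩
    have h2 : 1 - x / (1 + x) = 1 / (1 + x) := by field_simp; ring
    simp only [h2]
    field_simp

/-- `v ↦ v/(1 − v)` is injective on `(0, 1)`. -/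
lemma injOn_div_one_sub_Ioo : InjOn (fun v : ℝ => v / (1 - v)) (Ioo 0 1) := by
  intro v₁ hv₁ v₂ hv₂ h
  simp only at h
  rw [div_eq_div_iff (sub_pos.mpr hv₁.2).ne' (sub_pos.mpr hv₂.2).ne'] at h
  linear_combination h

/-- The derivative of `v ↦ v/(1 − v)` on `(0, 1)` is `(1 − v)^{-2}`. -/
lemma hasDerivWithinAt_div_one_sub {v : ℝ} (hv : v ∈ Ioo (0 : ℝ) 1) :
    HasDerivWithinAt (fun v : ℝ => v / (1 - v)) (1 / (1 - v) ^ 2) (Ioo 0 1) v := by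
  have h1 : (1 - v) ≠ 0 := (sub_pos.mpr hv.2).ne'
  refine (((hasDerivAt_id v).div ((hasDerivAt_id v).const_sub 1) h1).congr_deriv ?_).hasDerivWithinAt
  simp only [id]
  field_simp
  ring

/-- On `(0, 1)`: the substituted integrand `(1 − v)^{-2} · (v/(1−v))^{a−1} (1 + v/(1−v))^{-(a+b)}`
equals `v^{a−1} (1 − v)^{b−1}`. -/
lemma abs_inv_sq_smul_div_one_sub_rpow {v : ℝ} (hv : v ∈ Ioo (0 : ℝ) 1) (a b : ℝ) :
    |1 / (1 - v) ^ 2| • ((v / (1 - v)) ^ (a - 1) * (1 + v / (1 - v)) ^ (-(a + b)))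
      = v ^ (a - 1) * (1 - v) ^ (b - 1) := by
  have hv0 : 0 < v := hv.1
  have hv1 : 0 < 1 - v := sub_pos.mpr hv.2
  have h2 : 1 + v / (1 - v) = (1 - v)⁻¹ := by field_simp; ring
  rw [smul_eq_mul, abs_of_pos (one_div_pos.mpr (pow_pos hv1 2)), h2, Real.div_rpow hv0.le hv1.le,
    Real.inv_rpow hv1.le, Real.rpow_neg hv1.le, inv_inv,
    show a + b = (a - 1) + (b - 1) + 2 by ring, Real.rpow_add hv1, Real.rpow_add hv1, Real.rpow_two]
  have h3 : (1 - v) ^ (a - 1) ≠ 0 := (Real.rpow_pos_of_pos hv1 _).ne'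
  field_simp

/-- **The Beta integral on `(0, ∞)`**: `∫_0^∞ x^{a−1} (1 + x)^{-(a+b)} dx = Γ(a) Γ(b)/Γ(a + b)` for
`a, b > 0` (the substitution `x = v/(1 − v)`). -/
theorem integral_rpow_mul_one_add_rpow_neg {a b : ℝ} (ha : 0 < a) (hb : 0 < b) :
    ∫ x in Ioi (0 : ℝ), x ^ (a - 1) * (1 + x) ^ (-(a + b))
      = Real.Gamma a * Real.Gamma b / Real.Gamma (a + b) := by
  have key := integral_image_eq_integral_abs_deriv_smul measurableSet_Ioo
    (fun v hv => hasDerivWithinAt_div_one_sub hv) injOn_div_one_sub_Ioo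
    (fun x : ℝ => x ^ (a - 1) * (1 + x) ^ (-(a + b)))
  rw [image_div_one_sub_Ioo] at key
  rw [key, setIntegral_congr_fun measurableSet_Ioo
    (fun v hv => abs_inv_sq_smul_div_one_sub_rpow hv a b), ← integral_Ioc_eq_integral_Ioo,
    ← intervalIntegral.integral_of_le zero_le_one, integral_rpow_mul_one_sub_rpow ha hb]

/-- `x^{a−1} (1 + x)^{-(a+b)}` is integrable on `(0, ∞)` for `a, b > 0` (a posteriori). -/
theorem integrableOn_rpow_mul_one_add_rpow_neg {a b : ℝ} (ha : 0 < a) (hb : 0 < b) :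
    IntegrableOn (fun x : ℝ => x ^ (a - 1) * (1 + x) ^ (-(a + b))) (Ioi 0) := by
  by_contra h
  have h0 := integral_undef h
  rw [integral_rpow_mul_one_add_rpow_neg ha hb] at h0
  have h1 : 0 < Real.Gamma a := Real.Gamma_pos_of_pos ha
  have h2 : 0 < Real.Gamma b := Real.Gamma_pos_of_pos hb
  have h3 : 0 < Real.Gamma (a + b) := Real.Gamma_pos_of_pos (by linarith)
  have : 0 < Real.Gamma a * Real.Gamma b / Real.Gamma (a + b) := by positivity
  linarith

/-- The `(0, ∞)` Beta integral as a Mellin-type integral: for `a > 0` and `c > a`,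
`∫_0^∞ x^{a−1} (1 + x)^{-c} dx = Γ(a) Γ(c − a)/Γ(c)`. -/
theorem integral_rpow_mul_one_add_rpow_neg' {a c : ℝ} (ha : 0 < a) (hc : a < c) :
    ∫ x in Ioi (0 : ℝ), x ^ (a - 1) * (1 + x) ^ (-c)
      = Real.Gamma a * Real.Gamma (c - a) / Real.Gamma c := by
  have h := integral_rpow_mul_one_add_rpow_neg ha (sub_pos.mpr hc)
  rw [show a + (c - a) = c by ring] at h
  exact h

end Summit.Ventures.HodgeRepro2.T5SU11BetaImproper
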